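import Literature.Barriers.CriticalPhenomena.LongRangeTrivialityOnZ3Proofs

/-!
# Ferromagnetic pair interactions on `ℤ^d` in a magnetic field `h ≥ 0`: Griffiths' inequalities,
# the infinite-volume state `⟨·⟩_{J,h,β}` and the magnetisation `m*(β) = lim_{h→0⁺} ⟨σ₀⟩_{β,h}`

Sibling of `Literature/Barriers/CriticalPhenomena/LongRangeTrivialityOnZ3.lean` (barrier catalogue
D-0021, sub-problem `Ising3DConformalLimit`), first of the files serving the discharge of the named
fact `Literature.Barriers.CriticalPhenomena.panis_criticalBeta_pos` (Panis 2023, §1.2.1: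
"`β_c := inf{β > 0, m*(β) > 0} ∈ (0,∞)`. The above assumptions guarantee [Fisher 1967] that `β_c > 0`
(in fact `β_c ≥ |J|⁻¹`), while Peierls' celebrated argument yields the bound `β_c < ∞`", p. 6 of
arXiv:2309.05797). In the tree `β_c` is `sInf {β | 0 < β ∧ 0 < m*(β)}` (`LongRangeIsing.criticalBeta`)
with `m*(β) = limUnder_{h → 0⁺} ⟨σ₀⟩_{J,h,β}` and `⟨·⟩_{J,h,β} = limUnder_L ⟨·⟩_{Λ_L,J,h,β}`
(`LongRangeIsing.magnetization`, `LongRangeIsing.state`, both `limUnder`s), so `0 < β_c` needs the two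
limits to be actual limits **at positive field**, a positive lower bound on the set (Fisher's
`β_c ≥ |J|⁻¹`, `LongRangeTrivialityOnZ3HighTemperature.lean`) *and* its non-emptiness (Peierls,
`LongRangeTrivialityOnZ3LowTemperature.lean`).

`LongRangeTrivialityOnZ3Proofs.lean` identifies `⟨·⟩_{Λ,J,0,β}` with the spin system `ν_{Λ;K}` of
Friedli–Velenik §3.8.1 (`Literature.Probability.LatticeModels.gksExpect`) at **zero field**. This file
does the same at field `h`: the couplings are `K_{(z,w)} = (β/2)J_{z,w}` on the ordered pairs of `Λ`
(supports `{z} ∆ {w}`) and `K_z = βh` on the sites (supports `{z}`) — written inline as `Sum.elim`s,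
no new definition; `gksHamiltonian_pairField`, `expectIn_eq_gksExpect_field` — whence, for `β, h ≥ 0`
and `J ≥ 0` ("Using Griffiths' inequalities, one can obtain the associated infinite volume Gibbs
measure by taking weak limits", Panis 2023, §1.2.1):

* GKS I `expectIn_spinProduct_nonneg_field`; Griffiths' comparison of couplings in the three forms
  used downstream: in the volume (`expectIn_spinProduct_mono_volume_field`, through the decoupled
  couplings `expectIn_spinProduct_eq_gksExpect_decoupled_field`, Friedli–Velenik Exercise 3.12), in
  the field (`expectIn_spinProduct_mono_field`) and in the interaction (`expectIn_spinProduct_mono_coupling`);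
* the box limit `⟨σ_A⟩_{Λ_L,J,h,β} → ⟨σ_A⟩_{J,h,β}` (`tendsto_expectIn_box_field`, monotone and bounded),
  `expectIn_le_state_field`, `state_spinProduct_nonneg_field`, `state_spinProduct_le_one`,
  monotonicity of the state in the field (`state_spinProduct_mono_field`) and in the interaction
  (`state_spinProduct_mono_coupling`), and its translation invariance for translation-invariant `J`
  (`state_spinProduct_map_addRight_field`, Friedli–Velenik Exercise 3.14 / Thm. 3.17);
* the magnetisation: `h ↦ ⟨σ₀⟩_{J,h,β}` is nondecreasing on `[0,∞)`, so `m*(β)` is the limit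
  `lim_{h→0⁺}⟨σ₀⟩_{J,h,β}` (`tendsto_state_magnetization`), with the two comparison lemmas
  `le_magnetization_of_forall_le` and `magnetization_le_of_le` used by the two halves of `0 < β_c < ∞`.

## References

* R. Panis, arXiv:2309.05797 (2023) = Ann. Probab. 54 (2026), §1.2.1 (`⟨·⟩_{Λ,J,h,β}`, `⟨·⟩_{J,h,β}`,
  `m*(β)`, `β_c`) [Panis2023Triviality] (held; read pp. 5–6).
* S. Friedli, Y. Velenik, *Statistical Mechanics of Lattice Systems*, CUP (2017), §3.8.1 Thm. 3.49,
  Exercises 3.9, 3.12, 3.14, 3.31; Remark 3.30 (`m*` as `lim_{h↓0}`) [FriedliVelenik2017].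
* R. B. Griffiths, J. Math. Phys. 8 (1967) 478–489 (Griffiths' inequalities I, II).
-/

noncomputable section

namespace Literature.Barriers.CriticalPhenomena

open Literature.Probability.LatticeModels Literature.Probability.Percolation Filter Topology Finset
open scoped symmDiff

namespace LongRangeIsing

variable {d : ℕ}

/-! ### The pair interaction with field as a spin system `ν_{Λ;K}` on `↥Λ` -/

section FieldBridge

variable (J : Site d → Site d → ℝ) (Λ : Finset (Site d)) (β h : ℝ)

/-- `σ_{{x}} = σ_x` (local copy of `Literature.Probability.LatticeModels.spinProduct_singleton` of
`GriffithsMonotonicity`, not imported here). [folklore] -/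
theorem spinProduct_singleton_eq_spinAt {V : Type*} (x : V) : spinProduct ({x} : Finset V) = spinAt x := by
  funext σ
  simp [spinProduct]

/-- The couplings are nonnegative for `β, h ≥ 0`, `J ≥ 0` (ferromagnet in a nonnegative field). [folklore] -/
theorem pairFieldCoupling_nonneg (hβ : 0 ≤ β) (hh : 0 ≤ h) (hJ : ∀ x y, 0 ≤ J x y)
    (i : (↥Λ × ↥Λ) ⊕ ↥Λ) : 0 ≤ ((Sum.elim (fun p : ↥Λ × ↥Λ => β / 2 * J p.1 p.2) fun _ => β * h)) i := by
  rcases i with p | z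
  · exact mul_nonneg (by positivity) (hJ _ _)
  · exact mul_nonneg hβ hh

/-- **The energy identity**: `∑ᵢ Kᵢ τ_{Cᵢ} = -β H_{Λ,J,h}(τ·free)`, i.e.
`(β/2)∑_{x,y∈Λ} J_{x,y}σ_xσ_y + βh∑_{x∈Λ}σ_x`. [cite: Panis2023Triviality, §1.2.1 (H_{Λ,J,h})] -/
theorem gksHamiltonian_pairField (τ : SpinConfig ↥Λ) :
    gksHamiltonian (univ : Finset ((↥Λ × ↥Λ) ⊕ ↥Λ)) ((Sum.elim (fun p : ↥Λ × ↥Λ => β / 2 * J p.1 p.2) fun _ => β * h)) (Sum.elim (fun p : ↥Λ × ↥Λ => {p.1} ∆ {p.2}) fun z => {z}) τ =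
      -β * pairHamiltonian J Λ h (glue Λ τ .free) := by
  have hpair := gksHamiltonian_pair J Λ β τ
  rw [gksHamiltonian] at hpair ⊢
  rw [Fintype.sum_sum_type]
  simp only [Sum.elim_inl, Sum.elim_inr]
  rw [hpair]
  have hS : ∑ z : ↥Λ, β * h * spinProduct {z} τ = β * h * ∑ x ∈ Λ, spinAt x (glue Λ τ .free) := by
    rw [Finset.mul_sum, ← Finset.sum_coe_sort Λ]
    refine Finset.sum_congr rfl fun z _ => ?_
    rw [spinProduct_singleton_eq_spinAt, spinAt_glue_coe]
  rw [hS, pairHamiltonian, pairHamiltonian]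
  ring

/-- The Gibbs weight of `⟨·⟩_{Λ,J,h,β}` is the weight of `ν_{Λ;K}`. [folklore] -/
theorem pairGibbsWeight_eq_gksWeight_field (τ : SpinConfig ↥Λ) :
    pairGibbsWeight J Λ β h τ =
      gksWeight (univ : Finset ((↥Λ × ↥Λ) ⊕ ↥Λ)) ((Sum.elim (fun p : ↥Λ × ↥Λ => β / 2 * J p.1 p.2) fun _ => β * h)) (Sum.elim (fun p : ↥Λ × ↥Λ => {p.1} ∆ {p.2}) fun z => {z}) τ := by
  rw [pairGibbsWeight, gksWeight, gksHamiltonian_pairField]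

/-- `⟨F⟩_{Λ,J,h,β} = ⟨F(·free)⟩_{Λ;K}`. [folklore] -/
theorem expectIn_eq_gksExpect_field (F : SpinConfig (Site d) → ℝ) :
    expectIn J Λ β h F =
      gksExpect (univ : Finset ((↥Λ × ↥Λ) ⊕ ↥Λ)) ((Sum.elim (fun p : ↥Λ × ↥Λ => β / 2 * J p.1 p.2) fun _ => β * h)) (Sum.elim (fun p : ↥Λ × ↥Λ => {p.1} ∆ {p.2}) fun z => {z})
        (fun τ => F (glue Λ τ .free)) := by
  rw [expectIn, gksExpect, gksSum, gksSum]
  simp_rw [pairGibbsWeight_eq_gksWeight_field, one_mul]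

/-- `⟨σ_A⟩_{Λ,J,h,β} = ⟨σ_{A∩Λ}⟩_{Λ;K}`. [folklore] -/
theorem expectIn_spinProduct_eq_gksExpect_field (A : Finset (Site d)) :
    expectIn J Λ β h (spinProduct A) =
      gksExpect (univ : Finset ((↥Λ × ↥Λ) ⊕ ↥Λ)) ((Sum.elim (fun p : ↥Λ × ↥Λ => β / 2 * J p.1 p.2) fun _ => β * h)) (Sum.elim (fun p : ↥Λ × ↥Λ => {p.1} ∆ {p.2}) fun z => {z})
        (spinProduct (inVol Λ A)) := by
  rw [expectIn_eq_gksExpect_field]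
  simp_rw [spinProduct_glue_free]

/-- **Griffiths' first inequality in a field**: `⟨σ_A⟩_{Λ,J,h,β} ≥ 0` for `β, h ≥ 0`, `J ≥ 0`
(Griffiths 1967; Friedli–Velenik 2017, Thm. 3.49 (3.54)). [cite: FriedliVelenik2017, Thm. 3.49, eq. (3.54), p. 141] -/
theorem expectIn_spinProduct_nonneg_field (hβ : 0 ≤ β) (hh : 0 ≤ h) (hJ : ∀ x y, 0 ≤ J x y)
    (A : Finset (Site d)) : 0 ≤ expectIn J Λ β h (spinProduct A) := by
  rw [expectIn_spinProduct_eq_gksExpect_field]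
  exact gksExpect_spinProduct_nonneg _ _ _ (fun i _ => pairFieldCoupling_nonneg J Λ β h hβ hh hJ i) _

/-- **Monotonicity in the field** (Friedli–Velenik 2017, Exercise 3.9: correlations are nondecreasing
in `h ≥ 0`): `⟨σ_A⟩_{Λ,J,h,β} ≤ ⟨σ_A⟩_{Λ,J,h',β}` for `0 ≤ h ≤ h'`, `β ≥ 0`, `J ≥ 0`.
[cite: FriedliVelenik2017, Exercise 3.9, p. 109] -/
theorem expectIn_spinProduct_mono_field (hβ : 0 ≤ β) (hJ : ∀ x y, 0 ≤ J x y) {h₁ h₂ : ℝ}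
    (hh₁ : 0 ≤ h₁) (h12 : h₁ ≤ h₂) (A : Finset (Site d)) :
    expectIn J Λ β h₁ (spinProduct A) ≤ expectIn J Λ β h₂ (spinProduct A) := by
  rw [expectIn_spinProduct_eq_gksExpect_field, expectIn_spinProduct_eq_gksExpect_field]
  refine gksExpect_mono_of_abs_le _ _ (fun i _ => ?_) _
  rcases i with p | z
  · simp only [Sum.elim_inl]
    rw [abs_of_nonneg (mul_nonneg (by positivity) (hJ _ _))]
  · simp only [Sum.elim_inr]
    rw [abs_of_nonneg (mul_nonneg hβ hh₁)]
    exact mul_le_mul_of_nonneg_left h12 hβ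

/-- **Monotonicity in the interaction** (Griffiths' comparison inequality, Friedli–Velenik 2017,
Exercise 3.31): `|J'| ≤ J` entrywise gives `⟨σ_A⟩_{Λ,J',h,β} ≤ ⟨σ_A⟩_{Λ,J,h,β}` (`β, h ≥ 0`).
[cite: FriedliVelenik2017, Exercise 3.31, p. 142] -/
theorem expectIn_spinProduct_mono_coupling (hβ : 0 ≤ β) (hh : 0 ≤ h) {J' : Site d → Site d → ℝ}
    (hJJ' : ∀ x y, |J' x y| ≤ J x y) (A : Finset (Site d)) :
    expectIn J' Λ β h (spinProduct A) ≤ expectIn J Λ β h (spinProduct A) := by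
  rw [expectIn_spinProduct_eq_gksExpect_field, expectIn_spinProduct_eq_gksExpect_field]
  refine gksExpect_mono_of_abs_le _ _ (fun i _ => ?_) _
  rcases i with p | z
  · simp only [Sum.elim_inl]
    rw [abs_mul, abs_of_nonneg (by positivity : (0 : ℝ) ≤ β / 2)]
    exact mul_le_mul_of_nonneg_left (hJJ' _ _) (by positivity)
  · simp only [Sum.elim_inr]
    rw [abs_of_nonneg (mul_nonneg hβ hh)]

end FieldBridge

/-! ### Monotonicity in the volume at nonnegative field -/

section Volume

variable (J : Site d → Site d → ℝ) (β h : ℝ)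

/-- The energy of the decoupled system on `Λ₂ ⊇ Λ₁` (couplings and fields of `Λ₁` only), in lattice
coordinates: `-β H_{Λ₁,J,h}` of the restricted configuration.
[cite: FriedliVelenik2017, Exercise 3.12, p. 112] -/
theorem gksHamiltonian_pairField_restrict {Λ₁ Λ₂ : Finset (Site d)} (h12 : Λ₁ ⊆ Λ₂) (τ : SpinConfig ↥Λ₂) :
    gksHamiltonian (univ : Finset ((↥Λ₂ × ↥Λ₂) ⊕ ↥Λ₂))
        (Sum.elim (fun p : ↥Λ₂ × ↥Λ₂ => if (p.1 : Site d) ∈ Λ₁ ∧ (p.2 : Site d) ∈ Λ₁ then β / 2 * J p.1 p.2 else 0)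
          fun z : ↥Λ₂ => if (z : Site d) ∈ Λ₁ then β * h else 0)
        (Sum.elim (fun p : ↥Λ₂ × ↥Λ₂ => {p.1} ∆ {p.2}) fun z => {z}) τ =
      gksHamiltonian (univ : Finset ((↥Λ₁ × ↥Λ₁) ⊕ ↥Λ₁)) (Sum.elim (fun p : ↥Λ₁ × ↥Λ₁ => β / 2 * J p.1 p.2) fun _ => β * h) (Sum.elim (fun p : ↥Λ₁ × ↥Λ₁ => {p.1} ∆ {p.2}) fun z => {z})
        (τ ∘ volIncl h12) := by
  rw [gksHamiltonian_pairField, gksHamiltonian, Fintype.sum_sum_type]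
  simp only [Sum.elim_inl, Sum.elim_inr]
  have hP := gksHamiltonian_pair_restrict J Λ₂ β h12 τ
  rw [gksHamiltonian] at hP
  rw [hP]
  have hS : ∑ z : ↥Λ₂, (if (z : Site d) ∈ Λ₁ then β * h else 0) * spinProduct {z} τ =
      β * h * ∑ x ∈ Λ₁, spinAt x (glue Λ₁ (τ ∘ volIncl h12) .free) := by
    have h1 : ∑ z : ↥Λ₂, (if (z : Site d) ∈ Λ₁ then β * h else 0) * spinProduct {z} τ =
        ∑ x ∈ Λ₂, (if x ∈ Λ₁ then β * h else 0) * spinAt x (glue Λ₂ τ .free) := by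
      rw [← Finset.sum_coe_sort Λ₂]
      refine Finset.sum_congr rfl fun z _ => ?_
      rw [spinProduct_singleton_eq_spinAt, spinAt_glue_coe]
    rw [h1, Finset.mul_sum]
    symm
    refine (Finset.sum_congr rfl fun x hx => ?_).trans (Finset.sum_subset h12 fun x _ hx => ?_)
    · rw [if_pos hx, spinAt_glue_comp_volIncl h12 τ .free .free hx]
    · rw [if_neg hx, zero_mul]
  have hs : ∑ x ∈ Λ₁, ∑ y ∈ Λ₁, J x y * (spinAt x (glue Λ₂ τ .free) * spinAt y (glue Λ₂ τ .free)) =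
      ∑ x ∈ Λ₁, ∑ y ∈ Λ₁, J x y * spinAt x (glue Λ₁ (τ ∘ volIncl h12) .free) *
        spinAt y (glue Λ₁ (τ ∘ volIncl h12) .free) :=
    Finset.sum_congr rfl fun x hx => Finset.sum_congr rfl fun y hy => by
      rw [spinAt_glue_comp_volIncl h12 τ .free .free hx, spinAt_glue_comp_volIncl h12 τ .free .free hy,
        mul_assoc]
  rw [hS, hs, pairHamiltonian]
  ring

/-- The free expectation in `Λ₁` is the expectation in `Λ₂ ⊇ Λ₁` of the system whose couplings and
fields off `Λ₁` are switched off (the spins of `Λ₂ ∖ Λ₁` are then independent fair coins and cancel in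
the ratio; Friedli–Velenik 2017, Exercise 3.12). [cite: FriedliVelenik2017, Exercise 3.12, p. 112] -/
theorem expectIn_spinProduct_eq_gksExpect_decoupled_field {Λ₁ Λ₂ A : Finset (Site d)} (hA : A ⊆ Λ₁)
    (h12 : Λ₁ ⊆ Λ₂) :
    expectIn J Λ₁ β h (spinProduct A) =
      gksExpect (univ : Finset ((↥Λ₂ × ↥Λ₂) ⊕ ↥Λ₂))
        (Sum.elim (fun p : ↥Λ₂ × ↥Λ₂ => if (p.1 : Site d) ∈ Λ₁ ∧ (p.2 : Site d) ∈ Λ₁ then β / 2 * J p.1 p.2 else 0)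
          fun z : ↥Λ₂ => if (z : Site d) ∈ Λ₁ then β * h else 0)
        (Sum.elim (fun p : ↥Λ₂ × ↥Λ₂ => {p.1} ∆ {p.2}) fun z => {z}) (spinProduct (inVol Λ₂ A)) := by
  obtain ⟨c, hc, hsum⟩ := exists_sum_comp_eq_smul ℤˣ (volIncl h12) (volIncl_injective h12)
  rw [expectIn_spinProduct_eq_gksExpect_field, gksExpect, gksExpect, gksSum, gksSum, gksSum, gksSum]
  have hw : ∀ τ : SpinConfig ↥Λ₂,
      gksWeight (univ : Finset ((↥Λ₂ × ↥Λ₂) ⊕ ↥Λ₂))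
        (Sum.elim (fun p : ↥Λ₂ × ↥Λ₂ => if (p.1 : Site d) ∈ Λ₁ ∧ (p.2 : Site d) ∈ Λ₁ then β / 2 * J p.1 p.2 else 0)
          fun z : ↥Λ₂ => if (z : Site d) ∈ Λ₁ then β * h else 0)
        (Sum.elim (fun p : ↥Λ₂ × ↥Λ₂ => {p.1} ∆ {p.2}) fun z => {z}) τ =
      gksWeight (univ : Finset ((↥Λ₁ × ↥Λ₁) ⊕ ↥Λ₁)) (Sum.elim (fun p : ↥Λ₁ × ↥Λ₁ => β / 2 * J p.1 p.2) fun _ => β * h) (Sum.elim (fun p : ↥Λ₁ × ↥Λ₁ => {p.1} ∆ {p.2}) fun z => {z})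
        (τ ∘ volIncl h12) := fun τ => by
    rw [gksWeight, gksWeight, gksHamiltonian_pairField_restrict J β h h12]
  have hobs : ∀ τ : SpinConfig ↥Λ₂,
      spinProduct (inVol Λ₂ A) τ = spinProduct (inVol Λ₁ A) (τ ∘ volIncl h12) := by
    intro τ
    rw [← spinProduct_glue_free Λ₂ A τ, ← spinProduct_glue_free Λ₁ A (τ ∘ volIncl h12)]
    exact Finset.prod_congr rfl fun x hx => (spinAt_glue_comp_volIncl h12 τ .free .free (hA hx)).symm
  simp_rw [hw, hobs]
  rw [hsum (fun a => spinProduct (inVol Λ₁ A) a *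
      gksWeight (univ : Finset ((↥Λ₁ × ↥Λ₁) ⊕ ↥Λ₁)) (Sum.elim (fun p : ↥Λ₁ × ↥Λ₁ => β / 2 * J p.1 p.2) fun _ => β * h) (Sum.elim (fun p : ↥Λ₁ × ↥Λ₁ => {p.1} ∆ {p.2}) fun z => {z}) a),
    hsum (fun a => 1 *
      gksWeight (univ : Finset ((↥Λ₁ × ↥Λ₁) ⊕ ↥Λ₁)) (Sum.elim (fun p : ↥Λ₁ × ↥Λ₁ => β / 2 * J p.1 p.2) fun _ => β * h) (Sum.elim (fun p : ↥Λ₁ × ↥Λ₁ => {p.1} ∆ {p.2}) fun z => {z}) a),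
    nsmul_eq_mul, nsmul_eq_mul, mul_div_mul_left _ _ (by positivity)]

/-- **Monotonicity of free correlations in the volume, at field `h ≥ 0`** (Griffiths 1967;
Friedli–Velenik 2017, Exercise 3.12: `⟨σ_A⟩^∅_{Λ₁;β,h} ≤ ⟨σ_A⟩^∅_{Λ₂;β,h}` for `A ⊂ Λ₁ ⊂ Λ₂`,
`β, h ≥ 0`), for ferromagnetic pair interactions. [cite: FriedliVelenik2017, Exercise 3.12, p. 112] -/
theorem expectIn_spinProduct_mono_volume_field (hβ : 0 ≤ β) (hh : 0 ≤ h) (hJ : ∀ x y, 0 ≤ J x y)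
    {Λ₁ Λ₂ A : Finset (Site d)} (hA : A ⊆ Λ₁) (h12 : Λ₁ ⊆ Λ₂) :
    expectIn J Λ₁ β h (spinProduct A) ≤ expectIn J Λ₂ β h (spinProduct A) := by
  rw [expectIn_spinProduct_eq_gksExpect_decoupled_field J β h hA h12,
    expectIn_spinProduct_eq_gksExpect_field]
  refine gksExpect_mono_of_abs_le _ _ (fun i _ => ?_) _
  rcases i with p | z
  · have h0 : 0 ≤ β / 2 * J p.1 p.2 := mul_nonneg (by positivity) (hJ _ _)
    simp only [Sum.elim_inl]
    split_ifs
    · rw [abs_of_nonneg h0]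
    · rw [abs_zero]; exact h0
  · have h0 : 0 ≤ β * h := mul_nonneg hβ hh
    simp only [Sum.elim_inr]
    split_ifs
    · rw [abs_of_nonneg h0]
    · rw [abs_zero]; exact h0

end Volume

/-! ### The infinite-volume state at field `h ≥ 0` -/

section BoxLimit

variable (J : Site d → Site d → ℝ) (β h : ℝ)

/-- **Existence of the infinite-volume correlations at field `h ≥ 0`**: for `β ≥ 0`, `J ≥ 0`,
`⟨σ_A⟩_{Λ_L,J,h,β}` is eventually nondecreasing and bounded by `1`, hence converges to
`⟨σ_A⟩_{J,h,β} = state J β h σ_A` ("one can obtain the associated infinite volume Gibbs measure by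
taking weak limits", Panis 2023, §1.2.1). [cite: Panis2023Triviality, §1.2.1 (infinite volume Gibbs measure ⟨·⟩_{J,h,β})] -/
theorem tendsto_expectIn_box_field (hβ : 0 ≤ β) (hh : 0 ≤ h) (hJ : ∀ x y, 0 ≤ J x y) (A : Finset (Site d)) :
    Tendsto (fun L : ℕ => expectIn J (box d L) β h (spinProduct A)) atTop
      (𝓝 (state J β h (spinProduct A))) := by
  obtain ⟨L₀, hL₀⟩ := exists_forall_subset_box d A
  set u : ℕ → ℝ := fun L => expectIn J (box d L) β h (spinProduct A) with hu
  have hmono : Monotone (fun n => u (n + L₀)) := by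
    refine monotone_nat_of_le_succ fun n => ?_
    exact expectIn_spinProduct_mono_volume_field J β h hβ hh hJ (hL₀ _ (by omega)) (box_mono d (by omega))
  have hbdd : BddAbove (Set.range fun n => u (n + L₀)) := by
    refine ⟨1, ?_⟩
    rintro _ ⟨n, rfl⟩
    exact (le_abs_self _).trans (abs_expectIn_le_one J _ β h fun σ => abs_spinProduct_le_one A σ)
  have hconv : Tendsto u atTop (𝓝 (⨆ n, u (n + L₀))) :=
    (Filter.tendsto_add_atTop_iff_nat L₀).1 (tendsto_atTop_ciSup hmono hbdd)
  exact tendsto_nhds_limUnder ⟨_, hconv⟩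

/-- `⟨σ_A⟩_{Λ,J,h,β} ≤ ⟨σ_A⟩_{J,h,β}` for every finite `Λ ⊇ A` (`β, h ≥ 0`, `J ≥ 0`).
[cite: FriedliVelenik2017, Exercise 3.12, p. 112] -/
theorem expectIn_le_state_field (hβ : 0 ≤ β) (hh : 0 ≤ h) (hJ : ∀ x y, 0 ≤ J x y)
    {Λ A : Finset (Site d)} (hA : A ⊆ Λ) :
    expectIn J Λ β h (spinProduct A) ≤ state J β h (spinProduct A) := by
  obtain ⟨L₁, hL₁⟩ := exists_forall_subset_box d Λ
  refine ge_of_tendsto (tendsto_expectIn_box_field J β h hβ hh hJ A) ?_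
  filter_upwards [eventually_ge_atTop L₁] with L hL
  exact expectIn_spinProduct_mono_volume_field J β h hβ hh hJ hA (hL₁ L hL)

/-- GKS I in the limit: `0 ≤ ⟨σ_A⟩_{J,h,β}`. [cite: FriedliVelenik2017, Thm. 3.49, eq. (3.54), p. 141] -/
theorem state_spinProduct_nonneg_field (hβ : 0 ≤ β) (hh : 0 ≤ h) (hJ : ∀ x y, 0 ≤ J x y)
    (A : Finset (Site d)) : 0 ≤ state J β h (spinProduct A) :=
  ge_of_tendsto' (tendsto_expectIn_box_field J β h hβ hh hJ A) fun _ =>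
    expectIn_spinProduct_nonneg_field J _ β h hβ hh hJ A

/-- `⟨σ_A⟩_{J,h,β} ≤ 1`. [folklore] -/
theorem state_spinProduct_le_one (hβ : 0 ≤ β) (hh : 0 ≤ h) (hJ : ∀ x y, 0 ≤ J x y)
    (A : Finset (Site d)) : state J β h (spinProduct A) ≤ 1 :=
  le_of_tendsto' (tendsto_expectIn_box_field J β h hβ hh hJ A) fun _ =>
    (le_abs_self _).trans (abs_expectIn_le_one J _ β h fun σ => abs_spinProduct_le_one A σ)

/-- **The state is nondecreasing in the field**: `⟨σ_A⟩_{J,h₁,β} ≤ ⟨σ_A⟩_{J,h₂,β}` for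
`0 ≤ h₁ ≤ h₂` (limit of `expectIn_spinProduct_mono_field`). [cite: FriedliVelenik2017, Exercise 3.9, p. 109] -/
theorem state_spinProduct_mono_field (hβ : 0 ≤ β) (hJ : ∀ x y, 0 ≤ J x y) {h₁ h₂ : ℝ}
    (hh₁ : 0 ≤ h₁) (h12 : h₁ ≤ h₂) (A : Finset (Site d)) :
    state J β h₁ (spinProduct A) ≤ state J β h₂ (spinProduct A) :=
  le_of_tendsto_of_tendsto' (tendsto_expectIn_box_field J β h₁ hβ hh₁ hJ A)
    (tendsto_expectIn_box_field J β h₂ hβ (hh₁.trans h12) hJ A) fun _ =>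
    expectIn_spinProduct_mono_field J _ β hβ hJ hh₁ h12 A

/-- **The state is nondecreasing in the interaction**: `|J'| ≤ J`, `J' ≥ 0` gives
`⟨σ_A⟩_{J',h,β} ≤ ⟨σ_A⟩_{J,h,β}`. [cite: FriedliVelenik2017, Exercise 3.31, p. 142] -/
theorem state_spinProduct_mono_coupling (hβ : 0 ≤ β) (hh : 0 ≤ h) {J' : Site d → Site d → ℝ}
    (hJ' : ∀ x y, 0 ≤ J' x y) (hJJ' : ∀ x y, J' x y ≤ J x y) (A : Finset (Site d)) :
    state J' β h (spinProduct A) ≤ state J β h (spinProduct A) := by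
  have hJ : ∀ x y, 0 ≤ J x y := fun x y => (hJ' x y).trans (hJJ' x y)
  refine le_of_tendsto_of_tendsto' (tendsto_expectIn_box_field J' β h hβ hh hJ' A)
    (tendsto_expectIn_box_field J β h hβ hh hJ A) fun L => ?_
  exact expectIn_spinProduct_mono_coupling J _ β h hβ hh (fun x y => by
    rw [abs_of_nonneg (hJ' x y)]; exact hJJ' x y) A

/-- **Translation invariance of the state at field `h`**: for `β, h ≥ 0` and a translation-invariant
`J ≥ 0`, `⟨σ_{A+a}⟩_{J,h,β} = ⟨σ_A⟩_{J,h,β}` (covariance of the finite-volume expectations,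
`expectIn_spinProduct_map_addRight`, and monotonicity in the volume; Friedli–Velenik 2017,
Exercise 3.14 / Thm. 3.17). [cite: FriedliVelenik2017, Exercise 3.14, p. 115] -/
theorem state_spinProduct_map_addRight_field (hβ : 0 ≤ β) (hh : 0 ≤ h) (hJ : ∀ x y, 0 ≤ J x y)
    (hJt : ∀ a x y, J (x + a) (y + a) = J x y) (a : Site d) (A : Finset (Site d)) :
    state J β h (spinProduct (A.map (Equiv.addRight a).toEmbedding)) = state J β h (spinProduct A) := by
  have key : ∀ (b : Site d) (B : Finset (Site d)),
      state J β h (spinProduct B) ≤ state J β h (spinProduct (B.map (Equiv.addRight b).toEmbedding)) := by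
    intro b B
    obtain ⟨L₀, hL₀⟩ := exists_forall_subset_box d B
    refine le_of_tendsto (tendsto_expectIn_box_field J β h hβ hh hJ B) ?_
    filter_upwards [eventually_ge_atTop L₀] with L hL
    rw [← expectIn_spinProduct_map_addRight J β h b (hJt b) (box d L) B]
    exact expectIn_le_state_field J β h hβ hh hJ (Finset.map_subset_map.2 (hL₀ L hL))
  refine le_antisymm ?_ (key a A)
  have h2 := key (-a) (A.map (Equiv.addRight a).toEmbedding)
  have hAA : (A.map (Equiv.addRight a).toEmbedding).map (Equiv.addRight (-a)).toEmbedding = A := by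
    rw [Finset.map_map]
    convert Finset.map_refl (s := A)
    ext x
    simp
  rwa [hAA] at h2

/-- One-site form: `⟨σ_x⟩_{J,h,β} = ⟨σ₀⟩_{J,h,β}` for translation-invariant `J ≥ 0`, `β, h ≥ 0`.
[cite: FriedliVelenik2017, Exercise 3.14, p. 115] -/
theorem state_spinAt_eq_state_spinAt_zero (hβ : 0 ≤ β) (hh : 0 ≤ h) (hJ : ∀ x y, 0 ≤ J x y)
    (hJt : ∀ a x y, J (x + a) (y + a) = J x y) (x : Site d) :
    state J β h (spinAt x) = state J β h (spinAt 0) := by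
  have h1 : ({0} : Finset (Site d)).map (Equiv.addRight x).toEmbedding = {x} := by
    ext y; simp
  rw [← spinProduct_singleton_eq_spinAt, ← spinProduct_singleton_eq_spinAt, ← h1]
  exact state_spinProduct_map_addRight_field J β h hβ hh hJ hJt x {0}

end BoxLimit

/-! ### The magnetisation `m*(β) = lim_{h → 0⁺} ⟨σ₀⟩_{J,h,β}` -/

section Magnetization

variable (J : Site d → Site d → ℝ) (β : ℝ)

/-- **`m*(β)` is the limit of `⟨σ₀⟩_{J,h,β}` as `h → 0⁺`** (`β ≥ 0`, `J ≥ 0`): the one-point function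
is nondecreasing in `h ≥ 0`, so the right limit at `0` exists and `limUnder` is it
(Friedli–Velenik 2017, Remark 3.30; Panis 2023, §1.2.1, `m*(β) := lim_{h→0⁺}⟨σ₀⟩_{β,h}`).
[cite: Panis2023Triviality, §1.2.1 (m*(β))] -/
theorem tendsto_state_magnetization (hβ : 0 ≤ β) (hJ : ∀ x y, 0 ≤ J x y) :
    Tendsto (fun h => state J β h (spinAt 0)) (𝓝[>] (0 : ℝ)) (𝓝 (magnetization J β)) := by
  set f : ℝ → ℝ := fun h => state J β (max h 0) (spinProduct {0}) with hf
  have hmono : Monotone f := fun a b hab =>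
    state_spinProduct_mono_field J β hβ hJ (le_max_right a 0) (max_le_max hab le_rfl) {0}
  have h1 := hmono.tendsto_nhdsGT 0
  have h2 : Tendsto (fun h => state J β h (spinAt 0)) (𝓝[>] (0 : ℝ)) (𝓝 (sInf (f '' Set.Ioi 0))) := by
    refine h1.congr' ?_
    filter_upwards [self_mem_nhdsWithin] with h hh
    rw [hf]
    dsimp only
    rw [max_eq_left (le_of_lt hh), spinProduct_singleton_eq_spinAt]
  rw [magnetization, h2.limUnder_eq]
  exact h2

/-- A lower bound on `⟨σ₀⟩_{J,h,β}` for all small `h > 0` bounds `m*(β)` from below. [folklore] -/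
theorem le_magnetization_of_forall_le (hβ : 0 ≤ β) (hJ : ∀ x y, 0 ≤ J x y) {c δ : ℝ} (hδ : 0 < δ)
    (hc : ∀ h, 0 < h → h < δ → c ≤ state J β h (spinAt 0)) : c ≤ magnetization J β := by
  refine ge_of_tendsto (tendsto_state_magnetization J β hβ hJ) ?_
  have hmem : Set.Ioo (0 : ℝ) δ ∈ 𝓝[>] (0 : ℝ) := Ioo_mem_nhdsGT hδ
  filter_upwards [hmem] with h hh
  exact hc h hh.1 hh.2

/-- An upper bound `⟨σ₀⟩_{J,h,β} ≤ g(h)` for small `h > 0` with `g(h) → c` bounds `m*(β) ≤ c`. [folklore] -/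
theorem magnetization_le_of_le (hβ : 0 ≤ β) (hJ : ∀ x y, 0 ≤ J x y) {g : ℝ → ℝ} {c δ : ℝ} (hδ : 0 < δ)
    (hg : Tendsto g (𝓝[>] (0 : ℝ)) (𝓝 c)) (hle : ∀ h, 0 < h → h < δ → state J β h (spinAt 0) ≤ g h) :
    magnetization J β ≤ c := by
  refine le_of_tendsto_of_tendsto (tendsto_state_magnetization J β hβ hJ) hg ?_
  have hmem : Set.Ioo (0 : ℝ) δ ∈ 𝓝[>] (0 : ℝ) := Ioo_mem_nhdsGT hδ
  filter_upwards [hmem] with h hh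
  exact hle h hh.1 hh.2

/-- `0 ≤ m*(β)` for `β ≥ 0`, `J ≥ 0`. [folklore] -/
theorem magnetization_nonneg (hβ : 0 ≤ β) (hJ : ∀ x y, 0 ≤ J x y) : 0 ≤ magnetization J β :=
  le_magnetization_of_forall_le J β hβ hJ one_pos fun h hh _ => by
    rw [← spinProduct_singleton_eq_spinAt]
    exact state_spinProduct_nonneg_field J β h hβ hh.le hJ {0}

end Magnetization

end LongRangeIsing

end Literature.Barriers.CriticalPhenomena
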